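import Literature.NumberTheory.Irrationality.RhinViola2001.GroupStructure
import Literature.NumberTheory.Transcendental.BeukersZetaThreeIntegralsLegendreProofs
import Literature.NumberTheory.Transcendental.BeukersZetaThreeIntegralsDiagProofs
import HarnessLib

/-!
# Rhin–Viola 2001, Theorem 2.1 — the analytic steps: integrability, (2.10), the polynomial case, (2.11)

Topic `Literature/NumberTheory/Irrationality/RhinViola2001`. Second of three theorem-only companion files discharging the
named fact `theorem21` of `GroupStructure.lean`: G. Rhin, C. Viola, *The group structure for ζ(3)*, Acta Arith. **97** (2001)
269–293 [RhinViola2001], Theorem 2.1, proof pp. 274–275 (held text `paper:doi-10-4064-aa97-3-6`). For NATURAL parameters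
(the hypothesis of Theorem 2.1) this file proves, about the triple integral `I` (2.1) of `GroupStructure.lean`:

* on the open cube the integrand is the rational function `x^h(1−x)^l y^k(1−y)^s z^j(1−z)^q D^r/D^{q+h+1}`, `D = 1−(1−xy)z`
  (`integrand_nat`), absolutely integrable when `h ≤ k + r`, i.e. `m ≥ 0` ("finite if and only if `h, j, k, l, q, r, s ≥ 0` and
  `h ≤ k + r`", p. 271; `integrableOn_integrand_nat`, by the domination `x^h y^k D^r ≤ D^h`, `xy ≤ D`, `1−z ≤ D` and the tree's
  `Beukers.integrableOn_cube_of_le`);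
* the linear decomposition (2.10) from "`(1−x)(1−z) = 1 − x − (1−x)z`" (`integrand_decomp`, `I_decomp`);
* the polynomial case: "If `q+h−r < 0`, then `I` is the integral of a polynomial in `x, y, z` with integer coefficients and
  partial degrees `r+l−q−1`, `m+s−q−1`, `j+r−h−1`. Therefore `d_{r+l−q} d_{m+s−q} d_{j+r−h} I ∈ ℤ`" (`I_polynomial_case`, through an
  explicit `MvPolynomial (Fin 3) ℤ` with bounded partial degrees and `∫∫∫ x^a y^b z^c = 1/((a+1)(b+1)(c+1))`, `(a+1) ∣ d_A` —
  the pattern of the tree's `DiophantineApproximation/RhinViolaPolynomialCaseIntegrality.lean` for Rhin–Viola 2005);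
* the base case (2.11): `I(h,0,h,0,h,0,h,0) = ∫∫ −log(xy)/(1−xy) x^h y^h dx dy = −2Σ_{ν=1}^{h} ν^{−3} + 2ζ(3)` "by Lemma 1 of
  [Beukers]" (`I_star`: Fubini over `z` by the tree's `Beukers.integral_cube_eq_integral_square_integral`,
  `∫₀¹ dz/(1−(1−xy)z) = −log(xy)/(1−xy)` = `Beukers.integral_one_div_one_sub_mul`, and `Beukers.logKernelIntegral_diag_holds`).

HONEST FRAMING (cell pub-zeta5): systematic search; no irrationality claim unless certified; nothing here concerns `ζ(5)`.
Theorems only; no definition, no named fact.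

## References
* [RhinViola2001] G. Rhin, C. Viola, The group structure for ζ(3), Acta Arith. 97 (2001) 269–293, doi:10.4064/aa97-3-6,
  §2 (2.1), Theorem 2.1 (proof, (2.10)–(2.11)).
* [Beukers1979] F. Beukers, A note on the irrationality of ζ(2) and ζ(3), Bull. London Math. Soc. 11 (1979) 268–272, Lemma 1.
-/

noncomputable section

namespace Literature.NumberTheory.Irrationality.RhinViola2001

namespace TheoremTwoOne

open MeasureTheory Set
open Literature.NumberTheory.Transcendental (zetaValue)
open Literature.NumberTheory.Transcendental.Beukers (logKernelIntegral logKernelIntegral_diag_holds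
  integral_cube_eq_integral_square_integral integrableOn_cube_of_le den_pos mul_le_den one_sub_le_den
  measurableSet_cube volume_restrict_cube insertNth_two_eq integral_one_div_one_sub_mul)

/-! ### The cube and the integrand with natural exponents -/

/-- The open cube of `GroupStructure.lean` is the open cube of the tree's Beukers files. [cite: RhinViola2001, §2 (2.1)] -/
theorem cube_def : cube = {p : Fin 3 → ℝ | ∀ j, p j ∈ Ioo (0 : ℝ) 1} := rfl

/-- On the open cube `1 − (1−xy)z > 0`. [cite: RhinViola2001, §2 (2.1)] -/
theorem den_pos_of_mem {p : Fin 3 → ℝ} (hp : p ∈ cube) : 0 < 1 - (1 - p 0 * p 1) * p 2 :=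
  den_pos (hp 0) (hp 1) (hp 2)

/-- The open cube is measurable. [cite: RhinViola2001, §2 (2.1)] -/
theorem measurableSet_cube' : MeasurableSet cube := by rw [cube_def]; exact measurableSet_cube 3

/-- The integrand (2.1) for natural parameters, on the open cube, as a rational function with natural exponents:
`x^h(1−x)^l y^k(1−y)^s z^j(1−z)^q · D^r / D^{q+h+1}`, `D = 1−(1−xy)z`. [cite: RhinViola2001, §2 (2.1)] -/
theorem integrand_nat (h j k l m q r s : ℕ) {p : Fin 3 → ℝ} (hp : p ∈ cube) :
    integrand ⟨h, j, k, l, m, q, r, s⟩ p =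
      p 0 ^ h * (1 - p 0) ^ l * p 1 ^ k * (1 - p 1) ^ s * p 2 ^ j * (1 - p 2) ^ q *
        (1 - (1 - p 0 * p 1) * p 2) ^ r / (1 - (1 - p 0 * p 1) * p 2) ^ (q + h + 1) := by
  have hD := (den_pos_of_mem hp).ne'
  have hexp : ((q : ℤ) + h - r + 1) = ((q + h + 1 : ℕ) : ℤ) - (r : ℕ) := by push_cast; ring
  simp only [integrand, zpow_natCast, hexp, zpow_sub₀ hD]
  rw [div_div_eq_mul_div]

/-- The key inequality for absolute integrability: on the open cube, `x^h y^k D^r ≤ D^h` whenever `h ≤ k + r`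
(i.e. `m ≥ 0`), from `xy ≤ D ≤ 1`. [cite: RhinViola2001, §2 p. 271 (finiteness iff `h ≤ k + r`)] -/
theorem pow_mul_pow_mul_den_pow_le {h k r : ℕ} (hm : h ≤ k + r) {p : Fin 3 → ℝ} (hp : p ∈ cube) :
    p 0 ^ h * p 1 ^ k * (1 - (1 - p 0 * p 1) * p 2) ^ r ≤ (1 - (1 - p 0 * p 1) * p 2) ^ h := by
  have hx := hp 0
  have hy := hp 1
  have hz := hp 2
  have hx0 : 0 < p 0 := hx.1
  have hy0 : 0 < p 1 := hy.1
  have hD := den_pos_of_mem hp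
  have hDxy := mul_le_den hx hy hz
  have hD1 : 1 - (1 - p 0 * p 1) * p 2 ≤ 1 := by nlinarith [mul_pos hx.1 hy.1, hz.1, mul_lt_mul'' hx.2 hy.2 hx.1.le hy.1.le]
  set D := 1 - (1 - p 0 * p 1) * p 2 with hDdef
  rcases le_or_gt h r with hr | hr
  · calc p 0 ^ h * p 1 ^ k * D ^ r ≤ 1 * 1 * D ^ h := by
          apply mul_le_mul (mul_le_mul (pow_le_one₀ hx.1.le hx.2.le) (pow_le_one₀ hy.1.le hy.2.le)
            (by positivity) zero_le_one) (pow_le_pow_of_le_one hD.le hD1 hr) (by positivity) (by positivity)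
      _ = D ^ h := by ring
  · have hk : h - r ≤ k := by omega
    calc p 0 ^ h * p 1 ^ k * D ^ r ≤ p 0 ^ (h - r) * p 1 ^ (h - r) * D ^ r := by
          apply mul_le_mul_of_nonneg_right (mul_le_mul (pow_le_pow_of_le_one hx.1.le hx.2.le (by omega))
            (pow_le_pow_of_le_one hy.1.le hy.2.le hk) (by positivity) (by positivity)) (by positivity)
      _ = (p 0 * p 1) ^ (h - r) * D ^ r := by rw [mul_pow]
      _ ≤ D ^ (h - r) * D ^ r :=
          mul_le_mul_of_nonneg_right (pow_le_pow_left₀ (mul_pos hx.1 hy.1).le hDxy _) (by positivity)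
      _ = D ^ h := by rw [← pow_add]; congr 1; omega

/-- The rational form of the integrand is continuous on the open cube. [folklore] -/
private theorem continuousOn_ratForm (h j k l q s r n : ℕ) :
    ContinuousOn (fun p : Fin 3 → ℝ =>
      p 0 ^ h * (1 - p 0) ^ l * p 1 ^ k * (1 - p 1) ^ s * p 2 ^ j * (1 - p 2) ^ q *
        (1 - (1 - p 0 * p 1) * p 2) ^ r / (1 - (1 - p 0 * p 1) * p 2) ^ n) cube := by
  refine ContinuousOn.div (Continuous.continuousOn (by fun_prop)) (Continuous.continuousOn (by fun_prop)) ?_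
  intro p hp
  exact pow_ne_zero _ (den_pos_of_mem hp).ne'

/-- The rational form of the integrand is dominated by `1/(1−(1−xy)z)` on the open cube when `h ≤ k + r`.
[cite: RhinViola2001, §2 p. 271] -/
theorem abs_ratForm_le {h j k l q s r : ℕ} (hm : h ≤ k + r) {p : Fin 3 → ℝ} (hp : p ∈ cube) :
    |p 0 ^ h * (1 - p 0) ^ l * p 1 ^ k * (1 - p 1) ^ s * p 2 ^ j * (1 - p 2) ^ q *
        (1 - (1 - p 0 * p 1) * p 2) ^ r / (1 - (1 - p 0 * p 1) * p 2) ^ (q + h + 1)| ≤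
      1 / (1 - (1 - p 0 * p 1) * p 2) := by
  have hx := hp 0
  have hy := hp 1
  have hz := hp 2
  have hx0 : 0 < p 0 := hx.1
  have hy0 : 0 < p 1 := hy.1
  have hz0 : 0 < p 2 := hz.1
  have hD := den_pos_of_mem hp
  have h1x : 0 ≤ 1 - p 0 := by linarith [hx.2]
  have h1y : 0 ≤ 1 - p 1 := by linarith [hy.2]
  have h1z : 0 ≤ 1 - p 2 := by linarith [hz.2]
  set D := 1 - (1 - p 0 * p 1) * p 2 with hDdef
  rw [abs_of_nonneg (by positivity)]
  have key := pow_mul_pow_mul_den_pow_le hm hp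
  rw [← hDdef] at key
  have hzq : (1 - p 2) ^ q ≤ D ^ q := pow_le_pow_left₀ h1z (one_sub_le_den hx hy hz) q
  have hnum : p 0 ^ h * (1 - p 0) ^ l * p 1 ^ k * (1 - p 1) ^ s * p 2 ^ j * (1 - p 2) ^ q * D ^ r ≤
      D ^ h * D ^ q := by
    calc p 0 ^ h * (1 - p 0) ^ l * p 1 ^ k * (1 - p 1) ^ s * p 2 ^ j * (1 - p 2) ^ q * D ^ r
        = (p 0 ^ h * p 1 ^ k * D ^ r) * ((1 - p 0) ^ l * (1 - p 1) ^ s * p 2 ^ j) * (1 - p 2) ^ q := by ring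
      _ ≤ D ^ h * 1 * D ^ q := by
          apply mul_le_mul (mul_le_mul key ?_ (by positivity) (by positivity)) hzq (by positivity) (by positivity)
          calc (1 - p 0) ^ l * (1 - p 1) ^ s * p 2 ^ j ≤ 1 ^ l * 1 ^ s * 1 ^ j := by
                apply mul_le_mul (mul_le_mul (pow_le_pow_left₀ h1x (by linarith [hx.1]) l)
                  (pow_le_pow_left₀ h1y (by linarith [hy.1]) s) (by positivity) (by positivity))
                  (pow_le_pow_left₀ hz.1.le hz.2.le j) (by positivity) (by positivity)
            _ = 1 := by simp
      _ = D ^ h * D ^ q := by ring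
  rw [div_le_div_iff₀ (by positivity) hD]
  calc p 0 ^ h * (1 - p 0) ^ l * p 1 ^ k * (1 - p 1) ^ s * p 2 ^ j * (1 - p 2) ^ q * D ^ r * D
      ≤ D ^ h * D ^ q * D := mul_le_mul_of_nonneg_right hnum hD.le
    _ = 1 * D ^ (q + h + 1) := by ring

/-- **Absolute integrability** of the integrand (2.1) on the open cube for natural parameters with `h ≤ k + r`
("this integral is finite if and only if `h, j, k, l, q, r, s ≥ 0` and `h ≤ k + r`"). [cite: RhinViola2001, §2 p. 271] -/
theorem integrableOn_ratForm {h j k l q s r : ℕ} (hm : h ≤ k + r) :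
    IntegrableOn (fun p : Fin 3 → ℝ =>
      p 0 ^ h * (1 - p 0) ^ l * p 1 ^ k * (1 - p 1) ^ s * p 2 ^ j * (1 - p 2) ^ q *
        (1 - (1 - p 0 * p 1) * p 2) ^ r / (1 - (1 - p 0 * p 1) * p 2) ^ (q + h + 1)) cube := by
  rw [cube_def]
  exact integrableOn_cube_of_le zero_le_one (cube_def ▸ continuousOn_ratForm h j k l q s r (q + h + 1))
    fun p hp => abs_ratForm_le hm hp

/-- The integrand (2.1) is integrable on the open cube for natural parameters with `h ≤ k + r`.
[cite: RhinViola2001, §2 p. 271] -/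
theorem integrableOn_integrand_nat {h j k l m q r s : ℕ} (hm : h ≤ k + r) :
    IntegrableOn (integrand ⟨h, j, k, l, m, q, r, s⟩) cube :=
  (integrableOn_ratForm (j := j) (l := l) (q := q) (s := s) hm).congr_fun
    (fun _ hp => (integrand_nat h j k l m q r s hp).symm) measurableSet_cube'

/-- `I` for natural parameters is the integral of the rational form. [cite: RhinViola2001, §2 (2.1)] -/
theorem I_nat (h j k l m q r s : ℕ) :
    I ⟨h, j, k, l, m, q, r, s⟩ = ∫ p in cube,
      p 0 ^ h * (1 - p 0) ^ l * p 1 ^ k * (1 - p 1) ^ s * p 2 ^ j * (1 - p 2) ^ q *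
        (1 - (1 - p 0 * p 1) * p 2) ^ r / (1 - (1 - p 0 * p 1) * p 2) ^ (q + h + 1) :=
  setIntegral_congr_fun measurableSet_cube' fun _ hp => integrand_nat h j k l m q r s hp

/-! ### The linear decomposition (2.10) -/

/-- (2.10), pointwise on the open cube: with `(1−x)(1−z) = 1 − x − (1−x)z`,
`integrand(h,j,k,l+1,m+1,q+1,r+1,s) = integrand(h,j,k,l,m,q,r,s) − integrand(h+1,j,k,l,m,q,r+1,s)
 − integrand(h,j+1,k,l+1,m,q,r,s)`. [cite: RhinViola2001, Theorem 2.1 (proof, (2.10))] -/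
theorem integrand_decomp (h j k l m q r s : ℕ) {p : Fin 3 → ℝ} (hp : p ∈ cube) :
    integrand ⟨h, j, k, l + 1, m + 1, q + 1, r + 1, s⟩ p =
      integrand ⟨h, j, k, l, m, q, r, s⟩ p - integrand ⟨h + 1, j, k, l, m, q, r + 1, s⟩ p -
        integrand ⟨h, j + 1, k, l + 1, m, q, r, s⟩ p := by
  have hD := (den_pos_of_mem hp).ne'
  have e0 := integrand_nat h j k (l + 1) (m + 1) (q + 1) (r + 1) s hp
  have e1 := integrand_nat h j k l m q r s hp
  have e2 := integrand_nat (h + 1) j k l m q (r + 1) s hp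
  have e3 := integrand_nat h (j + 1) k (l + 1) m q r s hp
  push_cast at e0 e1 e2 e3
  rw [e0, e1, e2, e3]
  generalize 1 - (1 - p 0 * p 1) * p 2 = D at hD ⊢
  field_simp
  ring

/-- **(2.10), integrated**: `I(h,j,k,l+1,m+1,q+1,r+1,s) = I(h,j,k,l,m,q,r,s) − I(h+1,j,k,l,m,q,r+1,s) − I(h,j+1,k,l+1,m,q,r,s)`
for natural parameters with `h ≤ k + r` (all four integrands are then absolutely integrable).
[cite: RhinViola2001, Theorem 2.1 (proof, (2.10))] -/
theorem I_decomp (h j k l m q r s : ℕ) (hm : h ≤ k + r) :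
    I ⟨h, j, k, l + 1, m + 1, q + 1, r + 1, s⟩ =
      I ⟨h, j, k, l, m, q, r, s⟩ - I ⟨h + 1, j, k, l, m, q, r + 1, s⟩ - I ⟨h, j + 1, k, l + 1, m, q, r, s⟩ := by
  have i1 := integrableOn_integrand_nat (j := j) (l := l) (m := m) (q := q) (s := s) hm
  have i2 := integrableOn_integrand_nat (h := h + 1) (j := j) (k := k) (l := l) (m := m) (q := q) (r := r + 1)
    (s := s) (by omega)
  have i3 := integrableOn_integrand_nat (h := h) (j := j + 1) (k := k) (l := l + 1) (m := m) (q := q) (r := r)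
    (s := s) hm
  push_cast at i1 i2 i3
  have i12 : IntegrableOn (fun p => integrand ⟨h, j, k, l, m, q, r, s⟩ p - integrand ⟨h + 1, j, k, l, m, q, r + 1, s⟩ p)
      cube := i1.sub i2
  unfold I
  rw [← integral_sub i1 i2, ← integral_sub i12 i3]
  exact setIntegral_congr_fun measurableSet_cube' fun _ hp => integrand_decomp h j k l m q r s hp

/-! ### The base case (2.11) -/

/-- `x^t y^t/(1−(1−xy)z)` is integrable on the open cube. [cite: RhinViola2001, Theorem 2.1 (proof, (2.11))] -/
theorem integrableOn_star (t : ℕ) :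
    IntegrableOn (fun p : Fin 3 → ℝ => p 0 ^ t * p 1 ^ t / (1 - (1 - p 0 * p 1) * p 2))
      {p : Fin 3 → ℝ | ∀ j, p j ∈ Ioo (0 : ℝ) 1} := by
  refine integrableOn_cube_of_le (C := 1) zero_le_one ?_ ?_
  · exact ContinuousOn.div (Continuous.continuousOn (by fun_prop)) (Continuous.continuousOn (by fun_prop))
      fun p hp => (den_pos (hp 0) (hp 1) (hp 2)).ne'
  · intro p hp
    have hx := hp 0
    have hy := hp 1
    have hD := den_pos (hp 0) (hp 1) (hp 2)
    rw [abs_div, abs_of_pos hD, abs_mul, abs_of_nonneg (pow_nonneg hx.1.le t), abs_of_nonneg (pow_nonneg hy.1.le t)]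
    exact div_le_div_of_nonneg_right (mul_le_one₀ (pow_le_one₀ hx.1.le hx.2.le) (pow_nonneg hy.1.le t)
      (pow_le_one₀ hy.1.le hy.2.le)) hD.le

/-- **(2.11)**: `I(t,0,t,0,t,0,t,0) = ∫∫∫ x^t y^t dx dy dz/(1−(1−xy)z) = ∫∫ −log(xy)/(1−xy) x^t y^t dx dy
= −2Σ_{ν=1}^{t} ν^{−3} + 2ζ(3)` "by Lemma 1 of [Beukers]" (the tree's `Beukers.logKernelIntegral_diag_holds`).
[cite: RhinViola2001, Theorem 2.1 (proof, (2.11))] -/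
theorem I_star (t : ℕ) :
    I ⟨t, 0, t, 0, t, 0, t, 0⟩ = 2 * zetaValue 3 - 2 * ∑ ν ∈ Finset.range t, 1 / ((ν : ℝ) + 1) ^ 3 := by
  have hlog : logKernelIntegral t t = 2 * (zetaValue 3 - ∑ ν ∈ Finset.range t, 1 / ((ν : ℝ) + 1) ^ 3) :=
    logKernelIntegral_diag_holds t
  rw [mul_sub] at hlog
  have hI := I_nat t 0 t 0 t 0 t 0
  push_cast at hI
  rw [← hlog, hI]
  -- simplify the rational form: `D^t/D^{0+t+1} = 1/D`
  have hform : ∀ p ∈ cube, p 0 ^ t * (1 - p 0) ^ 0 * p 1 ^ t * (1 - p 1) ^ 0 * p 2 ^ 0 * (1 - p 2) ^ 0 *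
      (1 - (1 - p 0 * p 1) * p 2) ^ t / (1 - (1 - p 0 * p 1) * p 2) ^ (0 + t + 1) =
      p 0 ^ t * p 1 ^ t / (1 - (1 - p 0 * p 1) * p 2) := by
    intro p hp
    have hD := (den_pos_of_mem hp).ne'
    simp only [pow_zero, mul_one, zero_add]
    rw [div_eq_div_iff (pow_ne_zero _ hD) hD]
    ring
  rw [setIntegral_congr_fun measurableSet_cube' hform, cube_def,
    integral_cube_eq_integral_square_integral 2 _ (integrableOn_star t), logKernelIntegral]
  refine setIntegral_congr_fun (measurableSet_cube 2) fun w hw => ?_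
  have hx := hw 0
  have hy := hw 1
  simp only [insertNth_two_eq, Matrix.cons_val_zero, Matrix.cons_val_one, Matrix.cons_val_two,
    Matrix.head_cons, Matrix.tail_cons]
  have ha0 : 0 < 1 - w 0 * w 1 := by nlinarith [hx.1, hx.2, hy.1, hy.2, mul_lt_mul'' hx.2 hy.2 hx.1.le hy.1.le]
  have ha1 : 1 - w 0 * w 1 < 1 := by nlinarith [mul_pos hx.1 hy.1]
  have hker := integral_one_div_one_sub_mul ha0 ha1
  rw [sub_sub_cancel] at hker
  rw [intervalIntegral.integral_of_le zero_le_one, integral_Ioc_eq_integral_Ioo] at hker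
  have : (fun z : ℝ => w 0 ^ t * w 1 ^ t / (1 - (1 - w 0 * w 1) * z)) =
      fun z : ℝ => w 0 ^ t * w 1 ^ t * (1 / (1 - (1 - w 0 * w 1) * z)) := by
    funext z; rw [mul_one_div]
  rw [this, MeasureTheory.integral_const_mul, hker]
  ring

/-! ### The polynomial case `q + h − r < 0` -/

/-- Evaluation of an integer trivariate polynomial as a finite sum of monomials. [folklore] -/
private theorem aeval_eq_sum_coeff (f : MvPolynomial (Fin 3) ℤ) (v : Fin 3 → ℝ) :
    MvPolynomial.aeval v f =
      ∑ d ∈ f.support, ((MvPolynomial.coeff d f : ℤ) : ℝ) * (v 0 ^ d 0 * v 1 ^ d 1 * v 2 ^ d 2) := by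
  rw [MvPolynomial.aeval_def, MvPolynomial.eval₂_eq']
  refine Finset.sum_congr rfl fun d _ => ?_
  rw [Fin.prod_univ_three]
  simp

/-- Lebesgue measure restricted to the open cube is the product of three copies of Lebesgue measure on `(0,1)`.
[folklore] -/
private theorem volume_restrict_cube' :
    (volume : Measure (Fin 3 → ℝ)).restrict cube = Measure.pi fun _ : Fin 3 => (volume : Measure ℝ).restrict (Ioo 0 1) :=
  volume_restrict_cube 3

/-- `∫₀¹ tⁿ dt = 1/(n+1)` over the open interval. [folklore] -/
private theorem setIntegral_Ioo_pow (n : ℕ) : ∫ t in Ioo (0 : ℝ) 1, t ^ n = 1 / ((n : ℝ) + 1) := by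
  rw [← integral_Ioc_eq_integral_Ioo, ← intervalIntegral.integral_of_le zero_le_one, integral_pow]
  simp

/-- `∫∫∫_{(0,1)³} x^a y^b z^c dx dy dz = 1/((a+1)(b+1)(c+1))`. [folklore] -/
private theorem setIntegral_cube_monomial (a b c : ℕ) :
    ∫ p in cube, p 0 ^ a * p 1 ^ b * p 2 ^ c = 1 / (((a : ℝ) + 1) * ((b : ℝ) + 1) * ((c : ℝ) + 1)) := by
  have key := integral_fin_nat_prod_eq_prod (𝕜 := ℝ)
    (μ := fun _ : Fin 3 => (volume : Measure ℝ).restrict (Ioo 0 1)) (fun i t => t ^ (![a, b, c] i))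
  simp only [Fin.prod_univ_three, Matrix.cons_val_zero, Matrix.cons_val_one, Matrix.cons_val_two,
    Matrix.head_cons, Matrix.tail_cons] at key
  change ∫ p, p 0 ^ a * p 1 ^ b * p 2 ^ c ∂((volume : Measure (Fin 3 → ℝ)).restrict cube) = _
  rw [volume_restrict_cube', key, setIntegral_Ioo_pow, setIntegral_Ioo_pow, setIntegral_Ioo_pow]
  have ha : ((a : ℝ) + 1) ≠ 0 := by positivity
  have hb : ((b : ℝ) + 1) ≠ 0 := by positivity
  have hc : ((c : ℝ) + 1) ≠ 0 := by positivity
  field_simp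

/-- Monomials are integrable on the open cube. [folklore] -/
private theorem integrableOn_monomial (a b c : ℕ) : IntegrableOn (fun p : Fin 3 → ℝ => p 0 ^ a * p 1 ^ b * p 2 ^ c) cube := by
  rw [cube_def]
  refine integrableOn_cube_of_le (C := 1) zero_le_one (Continuous.continuousOn (by fun_prop)) fun p hp => ?_
  have hx := hp 0
  have hy := hp 1
  have hz := hp 2
  have hD := den_pos hx hy hz
  have hD1 : 1 - (1 - p 0 * p 1) * p 2 ≤ 1 := by nlinarith [mul_pos hx.1 hy.1, hz.1, mul_lt_mul'' hx.2 hy.2 hx.1.le hy.1.le]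
  rw [abs_of_nonneg (by have := hx.1.le; have := hy.1.le; have := hz.1.le; positivity)]
  calc p 0 ^ a * p 1 ^ b * p 2 ^ c ≤ 1 := by
        have h1 := pow_le_one₀ hx.1.le hx.2.le (n := a)
        have h2 := pow_le_one₀ hy.1.le hy.2.le (n := b)
        have h3 := pow_le_one₀ hz.1.le hz.2.le (n := c)
        calc p 0 ^ a * p 1 ^ b * p 2 ^ c ≤ 1 * 1 * 1 :=
              mul_le_mul (mul_le_mul h1 h2 (pow_nonneg hy.1.le b) zero_le_one) h3 (pow_nonneg hz.1.le c)
                (by positivity)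
          _ = 1 := by ring
    _ ≤ 1 / (1 - (1 - p 0 * p 1) * p 2) := by rw [le_div_iff₀ hD]; linarith

/-- `(n+1) ∣ d_A` for `n < A`, as an exact division in `ℚ`. [folklore] -/
private theorem cast_lcmUpto_div {A n : ℕ} (hn : n < A) :
    ((Nat.lcmUpto A / (n + 1) : ℕ) : ℚ) * ((n : ℚ) + 1) = Nat.lcmUpto A := by
  have hdvd : n + 1 ∣ Nat.lcmUpto A := by
    rw [Nat.lcmUpto]; exact Finset.dvd_lcm (Finset.mem_Icc.2 ⟨by omega, by omega⟩)
  exact_mod_cast Nat.div_mul_cancel hdvd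

/-- **`d_A d_B d_C ∫∫∫_{(0,1)³} f ∈ ℤ`** for an integer polynomial `f(x,y,z)` with `deg_x f < A`, `deg_y f < B`,
`deg_z f < C` ("`I` is the integral of a polynomial in `x, y, z` with integer coefficients and partial degrees …
Therefore `d_{r+l−q} d_{m+s−q} d_{j+r−h} I ∈ ℤ`"): monomialwise, `∫∫∫ x^a y^b z^c = 1/((a+1)(b+1)(c+1))` and
`(a+1) ∣ d_A`. [cite: RhinViola2001, Theorem 2.1 (proof, p. 274)] -/
theorem exists_rat_setIntegral_cube_aeval (f : MvPolynomial (Fin 3) ℤ) {A B C : ℕ}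
    (hA : f.degreeOf 0 < A) (hB : f.degreeOf 1 < B) (hC : f.degreeOf 2 < C) :
    ∃ ρ : ℚ, (∫ p in cube, (MvPolynomial.aeval p f : ℝ)) = ρ ∧
      ∃ z : ℤ, ((Nat.lcmUpto A * Nat.lcmUpto B * Nat.lcmUpto C : ℕ) : ℚ) * ρ = z := by
  refine ⟨∑ d ∈ f.support, ((MvPolynomial.coeff d f : ℤ) : ℚ) / (((d 0 : ℚ) + 1) * ((d 1 : ℚ) + 1) * ((d 2 : ℚ) + 1)),
    ?_, ∑ d ∈ f.support, MvPolynomial.coeff d f * (((Nat.lcmUpto A / (d 0 + 1) : ℕ) : ℤ) *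
      ((Nat.lcmUpto B / (d 1 + 1) : ℕ) : ℤ) * ((Nat.lcmUpto C / (d 2 + 1) : ℕ) : ℤ)), ?_⟩
  · simp only [aeval_eq_sum_coeff]
    rw [integral_finsetSum _ fun d _ => (integrableOn_monomial (d 0) (d 1) (d 2)).const_mul _]
    push_cast
    refine Finset.sum_congr rfl fun d _ => ?_
    rw [integral_const_mul, setIntegral_cube_monomial]
    ring
  · rw [Finset.mul_sum]
    simp only [Int.cast_sum, Int.cast_mul, Int.cast_natCast, Nat.cast_mul]
    refine Finset.sum_congr rfl fun d hd => ?_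
    have h0 : d 0 < A := lt_of_le_of_lt (MvPolynomial.monomial_le_degreeOf 0 hd) hA
    have h1 : d 1 < B := lt_of_le_of_lt (MvPolynomial.monomial_le_degreeOf 1 hd) hB
    have h2 : d 2 < C := lt_of_le_of_lt (MvPolynomial.monomial_le_degreeOf 2 hd) hC
    rw [← cast_lcmUpto_div h0, ← cast_lcmUpto_div h1, ← cast_lcmUpto_div h2]
    have : ((d 0 : ℚ) + 1) ≠ 0 := by positivity
    have : ((d 1 : ℚ) + 1) ≠ 0 := by positivity
    have : ((d 2 : ℚ) + 1) ≠ 0 := by positivity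
    field_simp

/-- The integrand of the polynomial case as an evaluation of
`S = X₀^h (1−X₀)^l X₁^k (1−X₁)^s X₂^j (1−X₂)^q (1 − (1 − X₀X₁)X₂)^e ∈ ℤ[X₀,X₁,X₂]`.
[cite: RhinViola2001, Theorem 2.1 (proof, p. 274)] -/
theorem aeval_rvPoly (h j k l q s e : ℕ) (p : Fin 3 → ℝ) :
    MvPolynomial.aeval p (MvPolynomial.X 0 ^ h * (1 - MvPolynomial.X 0) ^ l * MvPolynomial.X 1 ^ k *
        (1 - MvPolynomial.X 1) ^ s * MvPolynomial.X 2 ^ j * (1 - MvPolynomial.X 2) ^ q *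
        (1 - (1 - MvPolynomial.X 0 * MvPolynomial.X 1) * MvPolynomial.X 2) ^ e : MvPolynomial (Fin 3) ℤ) =
      p 0 ^ h * (1 - p 0) ^ l * p 1 ^ k * (1 - p 1) ^ s * p 2 ^ j * (1 - p 2) ^ q *
        (1 - (1 - p 0 * p 1) * p 2) ^ e := by
  simp

/-- Partial degrees of `S`: `deg_x S ≤ h + l + e`, `deg_y S ≤ k + s + e`, `deg_z S ≤ j + q + e` (RV: "partial degrees
`r+l−q−1`, `m+s−q−1`, `j+r−h−1`" for `e = r−h−q−1`). [cite: RhinViola2001, Theorem 2.1 (proof, p. 274)] -/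
theorem degreeOf_rvPoly_le (h j k l q s e : ℕ) (i : Fin 3) :
    (MvPolynomial.X 0 ^ h * (1 - MvPolynomial.X 0) ^ l * MvPolynomial.X 1 ^ k *
        (1 - MvPolynomial.X 1) ^ s * MvPolynomial.X 2 ^ j * (1 - MvPolynomial.X 2) ^ q *
        (1 - (1 - MvPolynomial.X 0 * MvPolynomial.X 1) * MvPolynomial.X 2) ^ e : MvPolynomial (Fin 3) ℤ).degreeOf i ≤
      h * (if i = 0 then 1 else 0) + l * (if i = 0 then 1 else 0) + k * (if i = 1 then 1 else 0) +
        s * (if i = 1 then 1 else 0) + j * (if i = 2 then 1 else 0) + q * (if i = 2 then 1 else 0) + e := by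
  have hX : ∀ i n : Fin 3, (MvPolynomial.X n : MvPolynomial (Fin 3) ℤ).degreeOf i = if i = n then 1 else 0 :=
    fun i n => MvPolynomial.degreeOf_X i n
  have a1 : ∀ n : Fin 3, ((1 : MvPolynomial (Fin 3) ℤ) - MvPolynomial.X n).degreeOf i ≤ if i = n then 1 else 0 :=
    fun n => (MvPolynomial.degreeOf_sub_le _ _ _).trans (by rw [MvPolynomial.degreeOf_one, hX]; simp)
  have a3 : ((1 : MvPolynomial (Fin 3) ℤ) - (1 - MvPolynomial.X 0 * MvPolynomial.X 1) * MvPolynomial.X 2).degreeOf i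
      ≤ 1 := by
    refine (MvPolynomial.degreeOf_sub_le _ _ _).trans (max_le (by rw [MvPolynomial.degreeOf_one]; omega) ?_)
    refine (MvPolynomial.degreeOf_mul_le _ _ _).trans ?_
    have b1 := (MvPolynomial.degreeOf_sub_le i (1 : MvPolynomial (Fin 3) ℤ) (MvPolynomial.X 0 * MvPolynomial.X 1)).trans
      (max_le (by rw [MvPolynomial.degreeOf_one]; exact Nat.zero_le _)
        (MvPolynomial.degreeOf_mul_le i (MvPolynomial.X 0 : MvPolynomial (Fin 3) ℤ) (MvPolynomial.X 1)))
    rw [hX, hX] at b1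
    have b2 := hX i 2
    fin_cases i <;> simp at b1 b2 ⊢ <;> omega
  have e1 := (MvPolynomial.degreeOf_pow_le i (MvPolynomial.X 0 : MvPolynomial (Fin 3) ℤ) h).trans
    (Nat.mul_le_mul_left h (le_of_eq (hX i 0)))
  have e2 := (MvPolynomial.degreeOf_pow_le i _ l).trans (Nat.mul_le_mul_left l (a1 0))
  have e3 := (MvPolynomial.degreeOf_pow_le i (MvPolynomial.X 1 : MvPolynomial (Fin 3) ℤ) k).trans
    (Nat.mul_le_mul_left k (le_of_eq (hX i 1)))
  have e4 := (MvPolynomial.degreeOf_pow_le i _ s).trans (Nat.mul_le_mul_left s (a1 1))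
  have e5 := (MvPolynomial.degreeOf_pow_le i (MvPolynomial.X 2 : MvPolynomial (Fin 3) ℤ) j).trans
    (Nat.mul_le_mul_left j (le_of_eq (hX i 2)))
  have e6 := (MvPolynomial.degreeOf_pow_le i _ q).trans (Nat.mul_le_mul_left q (a1 2))
  have e7 := (MvPolynomial.degreeOf_pow_le i _ e).trans (Nat.mul_le_mul_left e a3)
  have m1 := MvPolynomial.degreeOf_mul_le i (MvPolynomial.X 0 ^ h : MvPolynomial (Fin 3) ℤ) ((1 - MvPolynomial.X 0) ^ l)
  have m2 := MvPolynomial.degreeOf_mul_le i (MvPolynomial.X 0 ^ h * (1 - MvPolynomial.X 0) ^ l : MvPolynomial (Fin 3) ℤ)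
    (MvPolynomial.X 1 ^ k)
  have m3 := MvPolynomial.degreeOf_mul_le i
    (MvPolynomial.X 0 ^ h * (1 - MvPolynomial.X 0) ^ l * MvPolynomial.X 1 ^ k : MvPolynomial (Fin 3) ℤ)
    ((1 - MvPolynomial.X 1) ^ s)
  have m4 := MvPolynomial.degreeOf_mul_le i
    (MvPolynomial.X 0 ^ h * (1 - MvPolynomial.X 0) ^ l * MvPolynomial.X 1 ^ k * (1 - MvPolynomial.X 1) ^ s :
      MvPolynomial (Fin 3) ℤ) (MvPolynomial.X 2 ^ j)
  have m5 := MvPolynomial.degreeOf_mul_le i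
    (MvPolynomial.X 0 ^ h * (1 - MvPolynomial.X 0) ^ l * MvPolynomial.X 1 ^ k * (1 - MvPolynomial.X 1) ^ s *
      MvPolynomial.X 2 ^ j : MvPolynomial (Fin 3) ℤ) ((1 - MvPolynomial.X 2) ^ q)
  have m6 := MvPolynomial.degreeOf_mul_le i
    (MvPolynomial.X 0 ^ h * (1 - MvPolynomial.X 0) ^ l * MvPolynomial.X 1 ^ k * (1 - MvPolynomial.X 1) ^ s *
      MvPolynomial.X 2 ^ j * (1 - MvPolynomial.X 2) ^ q : MvPolynomial (Fin 3) ℤ)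
    ((1 - (1 - MvPolynomial.X 0 * MvPolynomial.X 1) * MvPolynomial.X 2) ^ e)
  omega

/-- **The polynomial case** ("If `q + h − r < 0`, then `I` is the integral of a polynomial in `x, y, z` with integer
coefficients and partial degrees `r+l−q−1`, `m+s−q−1`, `j+r−h−1`. Therefore `d_{r+l−q} d_{m+s−q} d_{j+r−h} I ∈ ℤ`"),
for natural parameters with `r = q + h + e + 1`: `I ∈ ℚ` and `d_{h+l+e+1} d_{k+s+e+1} d_{j+q+e+1} I ∈ ℤ`
(with (2.2) these indices are `r' = r+l−q`, `m' = m+s−q`, `j' = j+r−h`). [cite: RhinViola2001, Theorem 2.1 (proof, p. 274)] -/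
theorem I_polynomial_case (h j k l m q s e : ℕ) :
    ∃ ρ : ℚ, I ⟨h, j, k, l, m, q, q + h + e + 1, s⟩ = ρ ∧
      ∃ z : ℤ, ((Nat.lcmUpto (h + l + e + 1) * Nat.lcmUpto (k + s + e + 1) * Nat.lcmUpto (j + q + e + 1) : ℕ) : ℚ) *
        ρ = z := by
  obtain ⟨ρ, hρ, hz⟩ := exists_rat_setIntegral_cube_aeval
    (MvPolynomial.X 0 ^ h * (1 - MvPolynomial.X 0) ^ l * MvPolynomial.X 1 ^ k *
        (1 - MvPolynomial.X 1) ^ s * MvPolynomial.X 2 ^ j * (1 - MvPolynomial.X 2) ^ q *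
        (1 - (1 - MvPolynomial.X 0 * MvPolynomial.X 1) * MvPolynomial.X 2) ^ e : MvPolynomial (Fin 3) ℤ)
    (A := h + l + e + 1) (B := k + s + e + 1) (C := j + q + e + 1)
    (by have := degreeOf_rvPoly_le h j k l q s e 0; simp at this; omega)
    (by have := degreeOf_rvPoly_le h j k l q s e 1; simp at this; omega)
    (by have := degreeOf_rvPoly_le h j k l q s e 2; simp at this; omega)
  refine ⟨ρ, ?_, hz⟩
  have hI := I_nat h j k l m q (q + h + e + 1) s
  push_cast at hI
  rw [← hρ, hI]
  refine setIntegral_congr_fun measurableSet_cube' fun p hp => ?_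
  have hD := (den_pos_of_mem hp).ne'
  rw [aeval_rvPoly, div_eq_iff (pow_ne_zero _ hD)]
  ring

end TheoremTwoOne

end Literature.NumberTheory.Irrationality.RhinViola2001

end
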